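import Literature.Algebra.EuclideanLattices.AdjugateMachine
import HarnessLib

/-!
# Bricks for the Aharonov–Regev verifier machine: entrywise division, transposition, Gram matrices, squaring loops

Topic `Algebra/EuclideanLattices` (family `pqc`), machine-level toolkit in the `FP` string algebra of
`LLLMachineTables.lean` (`rowCode`/`matCode`, `dotF`), `FarCertMachineCodes.lean` (`idxList`, maps over
index lists) and `AdjugateMachine.lean` (`stepTF`, the product `T ↦ T Bᵀ` of row tables). Written for the
machine form of Regev 2009, Lemma 3.20 (the `GapCVP′ → DGS` reduction runs the integer Aharonov–Regev
verifier `ARVerifier.MAccepts` of `ARVerifierVectorCert.lean` on `N` decoded dual samples): that verifier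
needs, besides the bricks already in the tree, the five generic operations of this file, each a total
string function with its value on well-formed records and an ABSOLUTE output bound (registers saturated
at the width `|x|` of the yardstick `x`, `zcapF`, so that the maps and loops compose in `FP`):

* `divRowF` — entrywise integer division of a row by an integer: `rowCode v ↦ rowCode (i ↦ capZ (vᵢ / D))`
  (Lean's `Int` division, `zedivF`);
* `transposeF` — the capped transpose of a RECTANGULAR row table `R : Fin N' → Fin m → ℤ`:
  `matCode R ↦ matCode (l j ↦ capZ (R j l))`;
* `gramRF` — the capped Gram matrix of the rows of a rectangular table `U : Fin m → Fin N' → ℤ`: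
  `matCode U ↦ matCode (i k ↦ capZ (∑ⱼ U i j · U k j))` (`= U Uᵀ`; rectangular twin of `LLLMachine.gramF`);
* `sqLoopF` — `k` rounds of `T ↦ capped (T Tᵀ)` (`AdjMachine.stepTF` with `c = 0`) on a square table, a
  counted loop (`loopX`); for a symmetric `T` without saturation this is `T^{2^k}` (`iterate_mul_transpose_eq_pow`);
* `powLoopF` — `k` rounds of `a ↦ capZ (a²)` on an integer: `a^{2^k}` without saturation.

Everything is proved; no named facts.

## References

* D. Aharonov, O. Regev, *Lattice problems in NP ∩ coNP*, J. ACM 52 (2005) 749–765, §6 (the verifier: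
  Gram/moment matrix `W Wᵀ` and its largest eigenvalue). [AharonovRegev2005]
* O. Regev, *On lattices, learning with errors, random linear codes, and cryptography*, J. ACM 56
  (2009), art. 34 (arXiv:2401.03703), Lemma 3.20 (the verifier is run on `DGS` samples). [Regev2009]
* S. Arora, B. Barak, *Computational Complexity: A Modern Approach*, CUP 2009, §1.3 (polynomial time is
  closed under composition and bounded loops). [AroraBarak2009]
-/

noncomputable section

namespace Literature.Algebra.EuclideanLattices

open _root_.Computability Literature.Computability.Complexity Literature.Computability.Complexity.Brick Polynomial
open LLLMachine PRelSigPi FarCertMachine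
open scoped Matrix

namespace ARMachine

/-! ### Small facts on codes -/

/-- Entries of a row code by `elemOf`: `elemOf (rowCode v) i = dpEnc (v i)`. [folklore] -/
theorem elemOf_rowCode {m : ℕ} (v : Fin m → ℤ) (i : Fin m) : elemOf (rowCode v) i = dpEnc (v i) := by
  rw [rowCode, zlist_eq, elemOf_encList, List.map_ofFn, List.getD_eq_getElem _ _ (by simp)]
  simp

/-- Entries of a row code by `nthLF` (`l ≤ |x|`). [folklore] -/
theorem nthLF_rowCode (x : List Bool) {m : ℕ} (v : Fin m → ℤ) (l : Fin m) (hl : (l : ℕ) ≤ x.length) :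
    nthLF (boolPair x (boolPair (encodeNat l) (rowCode v))) = dpEnc (v l) := by
  rw [rowCode, zlist_eq, nthLF_apply x hl, List.map_ofFn, List.getD_eq_getElem _ _ (by simp)]
  simp

/-- `zcapF ⟨x, dpEnc z⟩ = dpEnc (capZ_|x| z)`. [folklore] -/
theorem zcapF_dpEnc_capZ (x : List Bool) (z : ℤ) : zcapF (boolPair x (dpEnc z)) = dpEnc (capZ x.length z) := by
  rw [zcapF_dpEnc, capZ]

/-! ### Entrywise division of a row by an integer -/

/-- The item of `divRowF` on `⟨x, ⟨⟨u, dD⟩, 1ⁱ⟩⟩`: `zcapF ⟨x, u[i] / dD⟩`. [folklore] -/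
def divItem : List Bool → List Bool :=
  zcapF ∘ fanoutFn (nthF 0) (zedivF ∘ fanoutFn (elemFn ∘ fanoutFn (sndPow 1) (fstF ∘ nthF 1)) (sndF ∘ nthF 1))

/-- `divItem ∈ FP`. [folklore] -/
theorem divItem_mem_FP : divItem ∈ FP :=
  comp_mem_FP zcapF_mem_FP (fanoutFn_mem_FP (nthF_mem_FP 0) (comp_mem_FP zedivF_mem_FP (fanoutFn_mem_FP
    (comp_mem_FP elemFn_mem_FP (fanoutFn_mem_FP (sndPow_mem_FP 1) (comp_mem_FP fstF_mem_FP (nthF_mem_FP 1))))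
    (comp_mem_FP sndF_mem_FP (nthF_mem_FP 1)))))

/-- Semantics of `divItem` (`i < n`). [folklore] -/
theorem divItem_apply (x : List Bool) {n : ℕ} (v : Fin n → ℤ) (D : ℤ) (i : Fin n) :
    divItem (boolPair x (boolPair (boolPair (rowCode v) (dpEnc D)) (ones i))) = dpEnc (capZ x.length (v i / D)) := by
  simp only [divItem, Function.comp_apply, fanoutFn_apply, nthF_zero_boolPair, nthF_succ_boolPair, sndPow_succ_boolPair,
    sndPow_zero, sndF_boolPair, fstF_boolPair, elemFn_boolPair, List.length_replicate]
  rw [elemOf_rowCode, zedivF_dpEnc, zcapF_dpEnc_capZ]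

/-- `divItem` saturates: `≤ 2|x| + 2`. [folklore] -/
theorem length_divItem_le (x p a : List Bool) :
    (divItem (boolPair x (boolPair p a))).length ≤ 0 * a.length + (2 * X + 2 : Polynomial ℕ).eval x.length := by
  have := length_zcapF_le (boolPair x ((zedivF ∘ fanoutFn (elemFn ∘ fanoutFn (sndPow 1) (fstF ∘ nthF 1)) (sndF ∘ nthF 1))
    (boolPair x (boolPair p a))))
  simp only [divItem, Function.comp_apply, fanoutFn_apply, nthF_zero_boolPair, fstF_boolPair, eval_add, eval_mul,
    eval_ofNat, eval_X, zero_mul, zero_add] at this ⊢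
  exact this

/-- **Entrywise division** on `⟨x, ⟨bin n, ⟨⟨rowCode v, dpEnc D⟩, idxList n⟩⟩⟩`: `rowCode (i ↦ capZ (vᵢ / D))`.
[folklore] -/
def divRowF : List Bool → List Bool := mapLF divItem

/-- `divRowF ∈ FP`. [folklore] -/
theorem divRowF_mem_FP : divRowF ∈ FP := mapLF_mem_FP divItem_mem_FP (w := 0) (by norm_num) length_divItem_le

/-- **Semantics of `divRowF`** (`n ≤ |x|`). [folklore] -/
theorem divRowF_apply (x : List Bool) {n : ℕ} (hn : n ≤ x.length) (v : Fin n → ℤ) (D : ℤ) :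
    divRowF (boolPair x (boolPair (encodeNat n) (boolPair (boolPair (rowCode v) (dpEnc D)) (idxList n)))) =
      rowCode (fun i : Fin n => capZ x.length (v i / D)) := by
  rw [divRowF, mapLF_idxList _ _ _ hn,
    rowCode_eq_map_range (fun i : Fin n => capZ x.length (v i / D))
      (fun i => if h : i < n then capZ x.length (v ⟨i, h⟩ / D) else 0) (fun i => by rw [dif_pos i.isLt])]
  refine congrArg encList (List.map_congr_left fun i hi => ?_)
  have hi' : i < n := List.mem_range.1 hi
  rw [dif_pos hi', divItem_apply x v D ⟨i, hi'⟩]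

/-- Length of `divRowF`: absolute, `≤ |x|(4|x| + 8)`. [folklore] -/
theorem length_divRowF_le (z : List Bool) : (divRowF z).length ≤ (fstF z).length * (4 * (fstF z).length + 8) := by
  have h := length_mapLF_le (f := divItem) 0 (P := 2 * X + 2) length_divItem_le z
  simp only [zero_mul, zero_add, eval_add, eval_mul, eval_ofNat, eval_X] at h
  rw [divRowF]
  nlinarith

/-! ### The capped transpose of a rectangular row table -/

/-- The entry item of the transpose on `⟨x, ⟨⟨M, 1ˡ⟩, 1ʲ⟩⟩`: `zcapF ⟨x, M[j][l]⟩`. [folklore] -/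
def tEntry : List Bool → List Bool :=
  zcapF ∘ fanoutFn (nthF 0) (nthLF ∘ fanoutFn (nthF 0) (fanoutFn (lenBinF ∘ sndF ∘ nthF 1)
    (elemFn ∘ fanoutFn (sndPow 1) (fstF ∘ nthF 1))))

/-- `tEntry ∈ FP`. [folklore] -/
theorem tEntry_mem_FP : tEntry ∈ FP :=
  comp_mem_FP zcapF_mem_FP (fanoutFn_mem_FP (nthF_mem_FP 0) (comp_mem_FP nthLF_mem_FP (fanoutFn_mem_FP (nthF_mem_FP 0)
    (fanoutFn_mem_FP (comp_mem_FP lenBinF_mem_FP (comp_mem_FP sndF_mem_FP (nthF_mem_FP 1)))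
      (comp_mem_FP elemFn_mem_FP (fanoutFn_mem_FP (sndPow_mem_FP 1) (comp_mem_FP fstF_mem_FP (nthF_mem_FP 1))))))))

/-- Semantics of `tEntry` (`j < N'`, `l < m`, `l ≤ |x|`). [folklore] -/
theorem tEntry_apply (x : List Bool) {N' m : ℕ} (R : Fin N' → Fin m → ℤ) (j : Fin N') (l : Fin m) (hl : (l : ℕ) ≤ x.length) :
    tEntry (boolPair x (boolPair (boolPair (matCode R) (ones l)) (ones j))) = dpEnc (capZ x.length (R j l)) := by
  simp only [tEntry, Function.comp_apply, fanoutFn_apply, nthF_zero_boolPair, nthF_succ_boolPair, sndPow_succ_boolPair,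
    sndPow_zero, sndF_boolPair, fstF_boolPair, elemFn_boolPair, List.length_replicate, lenBinF_apply]
  rw [AdjMachine.elemOf_matCode R j, nthLF_rowCode x (R j) l hl, zcapF_dpEnc_capZ]

/-- `tEntry` saturates: `≤ 2|x| + 2`. [folklore] -/
theorem length_tEntry_le (x p a : List Bool) :
    (tEntry (boolPair x (boolPair p a))).length ≤ 0 * a.length + (2 * X + 2 : Polynomial ℕ).eval x.length := by
  have := length_zcapF_le (boolPair x ((nthLF ∘ fanoutFn (nthF 0) (fanoutFn (lenBinF ∘ sndF ∘ nthF 1)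
    (elemFn ∘ fanoutFn (sndPow 1) (fstF ∘ nthF 1)))) (boolPair x (boolPair p a))))
  simp only [tEntry, Function.comp_apply, fanoutFn_apply, nthF_zero_boolPair, fstF_boolPair, eval_add, eval_mul,
    eval_ofNat, eval_X, zero_mul, zero_add] at this ⊢
  exact this

/-- **One column** on `⟨x, ⟨bin N', ⟨⟨M, 1ˡ⟩, idxList N'⟩⟩⟩`: `rowCode (j ↦ capZ (R j l))`. [folklore] -/
def tColF : List Bool → List Bool := mapLF tEntry

/-- `tColF ∈ FP`. [folklore] -/
theorem tColF_mem_FP : tColF ∈ FP := mapLF_mem_FP tEntry_mem_FP (w := 0) (by norm_num) length_tEntry_le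

/-- Semantics of `tColF` (`N' ≤ |x|`, `l < m`, `l ≤ |x|`). [folklore] -/
theorem tColF_apply (x : List Bool) {N' m : ℕ} (hN : N' ≤ x.length) (R : Fin N' → Fin m → ℤ) (l : Fin m)
    (hl : (l : ℕ) ≤ x.length) :
    tColF (boolPair x (boolPair (encodeNat N') (boolPair (boolPair (matCode R) (ones l)) (idxList N')))) =
      rowCode (fun j : Fin N' => capZ x.length (R j l)) := by
  rw [tColF, mapLF_idxList _ _ _ hN,
    rowCode_eq_map_range (fun j : Fin N' => capZ x.length (R j l))
      (fun j => if h : j < N' then capZ x.length (R ⟨j, h⟩ l) else 0) (fun j => by rw [dif_pos j.isLt])]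
  refine congrArg encList (List.map_congr_left fun j hj => ?_)
  have hj' : j < N' := List.mem_range.1 hj
  rw [dif_pos hj', tEntry_apply x R ⟨j, hj'⟩ l hl]

/-- Length of `tColF`: absolute, `≤ |x|(4|x| + 8)`. [folklore] -/
theorem length_tColF_le (z : List Bool) : (tColF z).length ≤ (fstF z).length * (4 * (fstF z).length + 8) := by
  have h := length_mapLF_le (f := tEntry) 0 (P := 2 * X + 2) length_tEntry_le z
  simp only [zero_mul, zero_add, eval_add, eval_mul, eval_ofNat, eval_X] at h
  rw [tColF]
  nlinarith

/-- The column item on `⟨x, ⟨⟨bin N', ⟨M, idx⟩⟩, 1ˡ⟩⟩`: `tColF ⟨x, ⟨bin N', ⟨⟨M, 1ˡ⟩, idx⟩⟩⟩`. [folklore] -/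
def tColItem : List Bool → List Bool :=
  tColF ∘ fanoutFn (nthF 0) (fanoutFn (fstF ∘ nthF 1) (fanoutFn (fanoutFn (nthF 1 ∘ nthF 1) (sndPow 1)) (sndPow 1 ∘ nthF 1)))

/-- `tColItem ∈ FP`. [folklore] -/
theorem tColItem_mem_FP : tColItem ∈ FP :=
  comp_mem_FP tColF_mem_FP (fanoutFn_mem_FP (nthF_mem_FP 0) (fanoutFn_mem_FP (comp_mem_FP fstF_mem_FP (nthF_mem_FP 1))
    (fanoutFn_mem_FP (fanoutFn_mem_FP (comp_mem_FP (nthF_mem_FP 1) (nthF_mem_FP 1)) (sndPow_mem_FP 1))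
      (comp_mem_FP (sndPow_mem_FP 1) (nthF_mem_FP 1)))))

/-- Semantics of `tColItem`. [folklore] -/
theorem tColItem_apply (x : List Bool) {N' m : ℕ} (hN : N' ≤ x.length) (R : Fin N' → Fin m → ℤ) (l : Fin m)
    (hl : (l : ℕ) ≤ x.length) :
    tColItem (boolPair x (boolPair (boolPair (encodeNat N') (boolPair (matCode R) (idxList N'))) (ones l))) =
      rowCode (fun j : Fin N' => capZ x.length (R j l)) := by
  simp only [tColItem, Function.comp_apply, fanoutFn_apply, nthF_zero_boolPair, nthF_succ_boolPair, fstF_boolPair,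
    sndPow_succ_boolPair, sndPow_zero, sndF_boolPair]
  exact tColF_apply x hN R l hl

/-- `tColItem` has absolutely bounded output. [folklore] -/
theorem length_tColItem_le (x p a : List Bool) :
    (tColItem (boolPair x (boolPair p a))).length ≤ 0 * a.length + (X * (4 * X + 8) : Polynomial ℕ).eval x.length := by
  have := length_tColF_le (boolPair x (boolPair (fstF p) (boolPair (boolPair (nthF 1 p) a) (sndPow 1 p))))
  simp only [tColItem, Function.comp_apply, fanoutFn_apply, nthF_zero_boolPair, nthF_succ_boolPair, fstF_boolPair,
    sndPow_succ_boolPair, sndPow_zero, sndF_boolPair, eval_add, eval_mul, eval_ofNat, eval_X, zero_mul, zero_add] at this ⊢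
  exact this

/-- **The capped transpose** on `⟨x, ⟨bin m, ⟨⟨bin N', ⟨matCode R, idxList N'⟩⟩, idxList m⟩⟩⟩` of a rectangular
row table `R : Fin N' → Fin m → ℤ`: `matCode (l j ↦ capZ (R j l))`. [folklore] -/
def transposeF : List Bool → List Bool := mapLF tColItem

/-- `transposeF ∈ FP`. [folklore] -/
theorem transposeF_mem_FP : transposeF ∈ FP := mapLF_mem_FP tColItem_mem_FP (w := 0) (by norm_num) length_tColItem_le

/-- **Semantics of `transposeF`** (`m, N' ≤ |x|`). [folklore] -/
theorem transposeF_apply (x : List Bool) {N' m : ℕ} (hN : N' ≤ x.length) (hm : m ≤ x.length) (R : Fin N' → Fin m → ℤ) :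
    transposeF (boolPair x (boolPair (encodeNat m) (boolPair (boolPair (encodeNat N') (boolPair (matCode R) (idxList N')))
      (idxList m)))) = matCode (fun (l : Fin m) (j : Fin N') => capZ x.length (R j l)) := by
  rw [transposeF, mapLF_idxList _ _ _ hm, AdjMachine.matCode_eq_map_range
      (fun (l : Fin m) (j : Fin N') => capZ x.length (R j l))
      (fun l => if h : l < m then rowCode (fun j : Fin N' => capZ x.length (R j ⟨l, h⟩)) else [])
      (fun l => by rw [dif_pos l.isLt])]
  refine congrArg encList (List.map_congr_left fun l hl => ?_)
  have hl' : l < m := List.mem_range.1 hl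
  rw [dif_pos hl', tColItem_apply x hN R ⟨l, hl'⟩ (le_trans (le_of_lt hl') hm)]

/-- Length of `transposeF`: absolute. [folklore] -/
theorem length_transposeF_le (z : List Bool) :
    (transposeF z).length ≤ (fstF z).length * (2 * ((fstF z).length * (4 * (fstF z).length + 8)) + 4) := by
  have h := length_mapLF_le (f := tColItem) 0 (P := X * (4 * X + 8)) length_tColItem_le z
  simp only [zero_mul, zero_add, eval_add, eval_mul, eval_ofNat, eval_X] at h
  rw [transposeF]
  exact h

/-! ### The capped Gram matrix of the rows of a rectangular table -/

/-- The entry item of the Gram matrix on `⟨x, ⟨⟨bin N', ⟨U, r⟩⟩, 1ᵏ⟩⟩`: `zcapF ⟨x, r · U[k]⟩`. [cite: AharonovRegev2005, §6 (the moment matrix W Wᵀ)] -/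
def grEntry : List Bool → List Bool :=
  zcapF ∘ fanoutFn (nthF 0) (dotF ∘ fanoutFn (nthF 0) (fanoutFn (fstF ∘ nthF 1) (fanoutFn (sndPow 1 ∘ nthF 1)
    (elemFn ∘ fanoutFn (sndPow 1) (nthF 1 ∘ nthF 1)))))

/-- `grEntry ∈ FP`. [folklore] -/
theorem grEntry_mem_FP : grEntry ∈ FP :=
  comp_mem_FP zcapF_mem_FP (fanoutFn_mem_FP (nthF_mem_FP 0) (comp_mem_FP dotF_mem_FP (fanoutFn_mem_FP (nthF_mem_FP 0)
    (fanoutFn_mem_FP (comp_mem_FP fstF_mem_FP (nthF_mem_FP 1)) (fanoutFn_mem_FP (comp_mem_FP (sndPow_mem_FP 1) (nthF_mem_FP 1))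
      (comp_mem_FP elemFn_mem_FP (fanoutFn_mem_FP (sndPow_mem_FP 1) (comp_mem_FP (nthF_mem_FP 1) (nthF_mem_FP 1)))))))))

/-- Semantics of `grEntry` (`N' ≤ |x|`, `k < m`). [folklore] -/
theorem grEntry_apply (x : List Bool) {N' m : ℕ} (hN : N' ≤ x.length) (U : Fin m → Fin N' → ℤ) (u : Fin N' → ℤ) (k : Fin m) :
    grEntry (boolPair x (boolPair (boolPair (encodeNat N') (boolPair (matCode U) (rowCode u))) (ones k))) =
      dpEnc (capZ x.length (∑ j, u j * U k j)) := by
  simp only [grEntry, Function.comp_apply, fanoutFn_apply, nthF_zero_boolPair, nthF_succ_boolPair, sndPow_succ_boolPair,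
    sndPow_zero, sndF_boolPair, fstF_boolPair, elemFn_boolPair, List.length_replicate]
  rw [AdjMachine.elemOf_matCode U k, dotF_apply x hN, zcapF_dpEnc_capZ]

/-- `grEntry` saturates: `≤ 2|x| + 2`. [folklore] -/
theorem length_gEntry_le (x p a : List Bool) :
    (grEntry (boolPair x (boolPair p a))).length ≤ 0 * a.length + (2 * X + 2 : Polynomial ℕ).eval x.length := by
  have := length_zcapF_le (boolPair x ((dotF ∘ fanoutFn (nthF 0) (fanoutFn (fstF ∘ nthF 1) (fanoutFn (sndPow 1 ∘ nthF 1)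
    (elemFn ∘ fanoutFn (sndPow 1) (nthF 1 ∘ nthF 1))))) (boolPair x (boolPair p a))))
  simp only [grEntry, Function.comp_apply, fanoutFn_apply, nthF_zero_boolPair, fstF_boolPair, eval_add, eval_mul,
    eval_ofNat, eval_X, zero_mul, zero_add] at this ⊢
  exact this

/-- **One row of the Gram matrix** on `⟨x, ⟨bin m, ⟨⟨bin N', ⟨U, rowCode u⟩⟩, idxList m⟩⟩⟩`:
`rowCode (k ↦ capZ (u · U k))`. [folklore] -/
def grRowF : List Bool → List Bool := mapLF grEntry

/-- `grRowF ∈ FP`. [folklore] -/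
theorem grRowF_mem_FP : grRowF ∈ FP := mapLF_mem_FP grEntry_mem_FP (w := 0) (by norm_num) length_gEntry_le

/-- Semantics of `grRowF` (`N', m ≤ |x|`). [folklore] -/
theorem grRowF_apply (x : List Bool) {N' m : ℕ} (hN : N' ≤ x.length) (hm : m ≤ x.length) (U : Fin m → Fin N' → ℤ) (u : Fin N' → ℤ) :
    grRowF (boolPair x (boolPair (encodeNat m) (boolPair (boolPair (encodeNat N') (boolPair (matCode U) (rowCode u))) (idxList m)))) =
      rowCode (fun k : Fin m => capZ x.length (∑ j, u j * U k j)) := by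
  rw [grRowF, mapLF_idxList _ _ _ hm,
    rowCode_eq_map_range (fun k : Fin m => capZ x.length (∑ j, u j * U k j))
      (fun k => if h : k < m then capZ x.length (∑ j, u j * U ⟨k, h⟩ j) else 0) (fun k => by rw [dif_pos k.isLt])]
  refine congrArg encList (List.map_congr_left fun k hk => ?_)
  have hk' : k < m := List.mem_range.1 hk
  rw [dif_pos hk', grEntry_apply x hN U u ⟨k, hk'⟩]

/-- Length of `grRowF`: absolute, `≤ |x|(4|x| + 8)`. [folklore] -/
theorem length_gRowF_le (z : List Bool) : (grRowF z).length ≤ (fstF z).length * (4 * (fstF z).length + 8) := by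
  have h := length_mapLF_le (f := grEntry) 0 (P := 2 * X + 2) length_gEntry_le z
  simp only [zero_mul, zero_add, eval_add, eval_mul, eval_ofNat, eval_X] at h
  rw [grRowF]
  nlinarith

/-- The row item of the Gram matrix on `⟨x, ⟨⟨bin m, ⟨bin N', ⟨U, idx⟩⟩⟩, 1ⁱ⟩⟩`:
`grRowF ⟨x, ⟨bin m, ⟨⟨bin N', ⟨U, U[i]⟩⟩, idx⟩⟩⟩`. [folklore] -/
def grRowItem : List Bool → List Bool :=
  grRowF ∘ fanoutFn (nthF 0) (fanoutFn (fstF ∘ nthF 1) (fanoutFn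
    (fanoutFn (nthF 1 ∘ nthF 1) (fanoutFn (nthF 2 ∘ nthF 1) (elemFn ∘ fanoutFn (sndPow 1) (nthF 2 ∘ nthF 1))))
    (sndPow 2 ∘ nthF 1)))

/-- `grRowItem ∈ FP`. [folklore] -/
theorem grRowItem_mem_FP : grRowItem ∈ FP :=
  comp_mem_FP grRowF_mem_FP (fanoutFn_mem_FP (nthF_mem_FP 0) (fanoutFn_mem_FP (comp_mem_FP fstF_mem_FP (nthF_mem_FP 1))
    (fanoutFn_mem_FP
      (fanoutFn_mem_FP (comp_mem_FP (nthF_mem_FP 1) (nthF_mem_FP 1)) (fanoutFn_mem_FP (comp_mem_FP (nthF_mem_FP 2) (nthF_mem_FP 1))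
        (comp_mem_FP elemFn_mem_FP (fanoutFn_mem_FP (sndPow_mem_FP 1) (comp_mem_FP (nthF_mem_FP 2) (nthF_mem_FP 1))))))
      (comp_mem_FP (sndPow_mem_FP 2) (nthF_mem_FP 1)))))

/-- Semantics of `grRowItem` (`N', m ≤ |x|`, `i < m`). [folklore] -/
theorem grRowItem_apply (x : List Bool) {N' m : ℕ} (hN : N' ≤ x.length) (hm : m ≤ x.length) (U : Fin m → Fin N' → ℤ) (i : Fin m) :
    grRowItem (boolPair x (boolPair (boolPair (encodeNat m) (boolPair (encodeNat N') (boolPair (matCode U) (idxList m)))) (ones i))) =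
      rowCode (fun k : Fin m => capZ x.length (∑ j, U i j * U k j)) := by
  simp only [grRowItem, Function.comp_apply, fanoutFn_apply, nthF_zero_boolPair, nthF_succ_boolPair, fstF_boolPair,
    sndPow_succ_boolPair, sndPow_zero, sndF_boolPair, elemFn_boolPair, List.length_replicate]
  rw [AdjMachine.elemOf_matCode U i]
  exact grRowF_apply x hN hm U (U i)

/-- `grRowItem` has absolutely bounded output. [folklore] -/
theorem length_gRowItem_le (x p a : List Bool) :
    (grRowItem (boolPair x (boolPair p a))).length ≤ 0 * a.length + (X * (4 * X + 8) : Polynomial ℕ).eval x.length := by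
  rw [grRowItem, Function.comp_apply]
  have := length_gRowF_le (fanoutFn (nthF 0) (fanoutFn (fstF ∘ nthF 1) (fanoutFn
    (fanoutFn (nthF 1 ∘ nthF 1) (fanoutFn (nthF 2 ∘ nthF 1) (elemFn ∘ fanoutFn (sndPow 1) (nthF 2 ∘ nthF 1))))
    (sndPow 2 ∘ nthF 1))) (boolPair x (boolPair p a)))
  simp only [fanoutFn_apply, nthF_zero_boolPair, fstF_boolPair, eval_add, eval_mul, eval_ofNat, eval_X, zero_mul,
    zero_add] at this ⊢
  exact this

/-- **The capped Gram matrix** on `w = ⟨x, ⟨bin m, ⟨bin N', matCode U⟩⟩⟩` of the rows of a RECTANGULAR table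
`U : Fin m → Fin N' → ℤ`: `matCode (i k ↦ capZ (∑ⱼ U i j · U k j))`, i.e. `U Uᵀ` saturated at width `|x|` (the map of
`grRowItem` over the index list `idxList m`, which the brick generates itself). Rectangular twin of the square
`LLLMachine.gramF` of `LLLMachineTables.lean` (whose inner dimension is the row count and whose output is a Cohen
table code). [cite: AharonovRegev2005, §6 (the moment matrix W Wᵀ)] -/
def gramRF : List Bool → List Bool :=
  mapLF grRowItem ∘ fanoutFn (nthF 0) (fanoutFn (nthF 1) (fanoutFn
    (fanoutFn (nthF 1) (fanoutFn (nthF 2) (fanoutFn (sndPow 2) (iotaF ∘ fanoutFn (nthF 0) (nthF 1)))))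
    (iotaF ∘ fanoutFn (nthF 0) (nthF 1))))

/-- `gramRF ∈ FP`. [folklore] -/
theorem gramRF_mem_FP : gramRF ∈ FP :=
  comp_mem_FP (mapLF_mem_FP grRowItem_mem_FP (w := 0) (by norm_num) length_gRowItem_le)
    (fanoutFn_mem_FP (nthF_mem_FP 0) (fanoutFn_mem_FP (nthF_mem_FP 1) (fanoutFn_mem_FP
      (fanoutFn_mem_FP (nthF_mem_FP 1) (fanoutFn_mem_FP (nthF_mem_FP 2) (fanoutFn_mem_FP (sndPow_mem_FP 2)
        (comp_mem_FP iotaF_mem_FP (fanoutFn_mem_FP (nthF_mem_FP 0) (nthF_mem_FP 1))))))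
      (comp_mem_FP iotaF_mem_FP (fanoutFn_mem_FP (nthF_mem_FP 0) (nthF_mem_FP 1))))))

/-- **Semantics of `gramRF`** (`N', m ≤ |x|`). [cite: AharonovRegev2005, §6 (the moment matrix W Wᵀ)] -/
theorem gramRF_apply (x : List Bool) {N' m : ℕ} (hN : N' ≤ x.length) (hm : m ≤ x.length) (U : Fin m → Fin N' → ℤ) :
    gramRF (boolPair x (boolPair (encodeNat m) (boolPair (encodeNat N') (matCode U)))) =
      matCode (fun i k : Fin m => capZ x.length (∑ j, U i j * U k j)) := by
  simp only [gramRF, Function.comp_apply, fanoutFn_apply, nthF_zero_boolPair, nthF_succ_boolPair, sndPow_succ_boolPair,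
    sndPow_zero, sndF_boolPair, iotaF_apply x hm]
  rw [mapLF_idxList _ _ _ hm, AdjMachine.matCode_eq_map_range
      (fun i k : Fin m => capZ x.length (∑ j, U i j * U k j))
      (fun i => if h : i < m then rowCode (fun k : Fin m => capZ x.length (∑ j, U ⟨i, h⟩ j * U k j)) else [])
      (fun i => by rw [dif_pos i.isLt])]
  refine congrArg encList (List.map_congr_left fun i hi => ?_)
  have hi' : i < m := List.mem_range.1 hi
  rw [dif_pos hi', grRowItem_apply x hN hm U ⟨i, hi'⟩]

/-! ### Repeated squaring of a square row table: `T ↦ T Tᵀ`, `k` rounds -/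

/-- The argument `⟨x, ⟨nn, ⟨T, ⟨idx, ⟨dpEnc 0, T⟩⟩⟩⟩⟩` of `stepTF` assembled from the loop record
`z = ⟨x, ⟨cnt, ⟨nn, ⟨idx, T⟩⟩⟩⟩` (`stepTF` with `c = 0` is the capped product `T Tᵀ`). [folklore] -/
def sqArg : List Bool → List Bool :=
  fanoutFn (nthF 0) (fanoutFn (nthF 2) (fanoutFn (sndPow 3) (fanoutFn (nthF 3) (fanoutFn (fun _ => dpEnc 0) (sndPow 3)))))

/-- `sqArg ∈ FP`. [folklore] -/
theorem sqArg_mem_FP : sqArg ∈ FP :=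
  fanoutFn_mem_FP (nthF_mem_FP 0) (fanoutFn_mem_FP (nthF_mem_FP 2) (fanoutFn_mem_FP (sndPow_mem_FP 3)
    (fanoutFn_mem_FP (nthF_mem_FP 3) (fanoutFn_mem_FP (const_mem_FP _) (sndPow_mem_FP 3)))))

/-- The squaring body: the new state `⟨nn, ⟨idx, stepTF (sqArg z)⟩⟩`. [cite: AharonovRegev2005, §6 test (c) (powers of the moment matrix)] -/
def sqBody : List Bool → List Bool :=
  fanoutFn (nthF 2) (fanoutFn (nthF 3) (AdjMachine.stepTF ∘ sqArg))

/-- `sqBody ∈ FP`. [folklore] -/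
theorem sqBody_mem_FP : sqBody ∈ FP :=
  fanoutFn_mem_FP (nthF_mem_FP 2) (fanoutFn_mem_FP (nthF_mem_FP 3) (comp_mem_FP AdjMachine.stepTF_mem_FP sqArg_mem_FP))

/-- The mathematical squaring step: `T' k i = capZ_W (∑ₜ T k t · T i t)` (`= (T Tᵀ) k i`, capped). [folklore] -/
def sqStep {n : ℕ} (W : ℕ) (T : Matrix (Fin n) (Fin n) ℤ) : Matrix (Fin n) (Fin n) ℤ :=
  fun k i => capZ W ((T * Tᵀ) k i)

/-- `sqStep` is `AdjMachine.stepRows` with `B = T` and `c = 0`. [folklore] -/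
theorem stepRows_self_zero {n : ℕ} (W : ℕ) (T : Matrix (Fin n) (Fin n) ℤ) :
    AdjMachine.stepRows W T 0 T = sqStep W T := by
  funext k i
  simp only [AdjMachine.stepRows, sqStep, ite_self, add_zero, Matrix.mul_apply, Matrix.transpose_apply]

/-- **Semantics of the squaring body** on a well-formed record (`n ≤ |x|`). [folklore] -/
theorem sqBody_apply (x cnt : List Bool) {n : ℕ} (hn : n ≤ x.length) (T : Matrix (Fin n) (Fin n) ℤ) :
    sqBody (boolPair x (boolPair cnt (boolPair (encodeNat n) (boolPair (idxList n) (matCode (fun k i => T k i)))))) =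
      boolPair (encodeNat n) (boolPair (idxList n) (matCode (fun k i => sqStep x.length T k i))) := by
  simp only [sqBody, sqArg, Function.comp_apply, fanoutFn_apply, nthF_zero_boolPair, nthF_succ_boolPair, sndPow_succ_boolPair,
    sndPow_zero, sndF_boolPair]
  rw [AdjMachine.stepTF_apply x hn T (fun k i => T k i) 0]
  have e : (fun k i : Fin n => capZ x.length (∑ t, T k t * T i t + if k = i then (0 : ℤ) else 0)) =
      fun k i => sqStep x.length T k i := by
    rw [← stepRows_self_zero]; rfl
  rw [e]

/-- **Growth of the squaring body**: `|sqBody z| ≤ |state| + P(|x|)` on EVERY record. [folklore] -/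
theorem length_sqBody_le (z : List Bool) :
    (sqBody z).length ≤ (sndPow 1 z).length + (X * (2 * (X * (4 * X + 8)) + 4) + 4 : Polynomial ℕ).eval (fstF z).length := by
  simp only [sqBody, fanoutFn_apply, Function.comp_apply, length_boolPair]
  have h2 : 2 * (nthF 2 z).length + (sndPow 2 z).length ≤ (sndPow 1 z).length := length_nthF_succ_add_sndPow_succ_le 1 z
  have h3 : 2 * (nthF 3 z).length + (sndPow 3 z).length ≤ (sndPow 2 z).length := length_nthF_succ_add_sndPow_succ_le 2 z
  have hT := AdjMachine.length_stepTF_le (sqArg z)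
  have e0 : fstF (sqArg z) = fstF z := by simp [sqArg]
  rw [e0] at hT
  simp only [eval_add, eval_mul, eval_X, eval_ofNat]
  generalize (fstF z).length * (2 * ((fstF z).length * (4 * (fstF z).length + 8)) + 4) = P at hT ⊢
  omega

/-- **The squaring loop** `loopX sqBody`: on `⟨x, ⟨bin k, ⟨nn, ⟨idx, T⟩⟩⟩⟩` with `k ≤ |x|`, `k` rounds of
`T ↦ capped (T Tᵀ)`. [cite: AharonovRegev2005, §6 test (c) (powers of the moment matrix)] -/
def sqLoopF : List Bool → List Bool := loopX sqBody

/-- `sqLoopF ∈ FP`. [cite: AroraBarak2009, §1.3 (bounded loops)] -/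
theorem sqLoopF_mem_FP : sqLoopF ∈ FP := loopX_mem_FP sqBody_mem_FP length_sqBody_le

/-- The loop model of the squaring body iterates `sqStep`. [folklore] -/
theorem loopModel_sqBody (x : List Bool) {n : ℕ} (hn : n ≤ x.length) : ∀ (k : ℕ) (T : Matrix (Fin n) (Fin n) ℤ),
    loopModel sqBody x k (boolPair (encodeNat n) (boolPair (idxList n) (matCode (fun a b => T a b)))) =
      boolPair (encodeNat n) (boolPair (idxList n) (matCode (fun a b => ((sqStep x.length)^[k] T) a b)))
  | 0, T => by simp [loopModel]
  | k + 1, T => by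
    rw [loopModel, sqBody_apply x _ hn T, loopModel_sqBody x hn k (sqStep x.length T), Function.iterate_succ_apply]

/-- **Semantics of `sqLoopF`** (`n, k ≤ |x|`): the state after `k` capped squarings. [folklore] -/
theorem sqLoopF_apply (x : List Bool) {n k : ℕ} (hn : n ≤ x.length) (hk : k ≤ x.length) (T : Matrix (Fin n) (Fin n) ℤ) :
    sqLoopF (boolPair x (boolPair (encodeNat k) (boolPair (encodeNat n) (boolPair (idxList n) (matCode (fun a b => T a b)))))) =
      boolPair x (boolPair [] (boolPair (encodeNat n) (boolPair (idxList n)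
        (matCode (fun a b => ((sqStep x.length)^[k] T) a b))))) := by
  rw [sqLoopF, loopX_apply _ _ _ hk, loopModel_sqBody x hn k T]

/-- Without saturation the capped squaring is `T ↦ T Tᵀ`. [folklore] -/
theorem sqStep_eq_of_lt {n : ℕ} {W : ℕ} {T : Matrix (Fin n) (Fin n) ℤ} (h : ∀ k i, ((T * Tᵀ) k i).natAbs < 2 ^ W) :
    sqStep W T = T * Tᵀ := by
  funext k i
  exact capZ_of_lt (h k i)

/-- **Iterated squaring of a symmetric matrix**: `(M ↦ M Mᵀ)^[k] T = T^(2^k)` for `Tᵀ = T`. [folklore] -/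
theorem iterate_mul_transpose_eq_pow {n : ℕ} (T : Matrix (Fin n) (Fin n) ℤ) (hT : Tᵀ = T) :
    ∀ k : ℕ, (fun M : Matrix (Fin n) (Fin n) ℤ => M * Mᵀ)^[k] T = T ^ 2 ^ k
  | 0 => by simp
  | k + 1 => by
    rw [Function.iterate_succ_apply', iterate_mul_transpose_eq_pow T hT k, Matrix.transpose_pow, hT, ← pow_add,
      pow_succ, Nat.mul_two]

/-- **The unsaturated squaring loop**: if every power `T^(2^j)`, `j ≤ k`, of the symmetric `T` has entries below
`2^W`, then `(sqStep W)^[k] T = T^(2^k)`. [folklore] -/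
theorem iterate_sqStep_eq_pow {n : ℕ} {W : ℕ} (T : Matrix (Fin n) (Fin n) ℤ) (hT : Tᵀ = T) :
    ∀ k : ℕ, (∀ j ≤ k, ∀ a b, ((T ^ 2 ^ j) a b).natAbs < 2 ^ W) → (sqStep W)^[k] T = T ^ 2 ^ k
  | 0, _ => by simp
  | k + 1, h => by
    have ih := iterate_sqStep_eq_pow T hT k (fun j hj => h j (Nat.le_succ_of_le hj))
    have hsym : (T ^ 2 ^ k)ᵀ = T ^ 2 ^ k := by rw [Matrix.transpose_pow, hT]
    have hsq : T ^ 2 ^ k * (T ^ 2 ^ k)ᵀ = T ^ 2 ^ (k + 1) := by rw [hsym, ← pow_add, pow_succ, Nat.mul_two]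
    rw [Function.iterate_succ_apply', ih, sqStep_eq_of_lt, hsq]
    intro a b
    rw [hsq]
    exact h (k + 1) le_rfl a b

/-! ### Repeated squaring of an integer: `a ↦ a²`, `k` rounds -/

/-- The body of the power loop on `⟨x, ⟨cnt, a⟩⟩`: `zcapF ⟨x, a · a⟩`. [folklore] -/
def powBody : List Bool → List Bool :=
  zcapF ∘ fanoutFn (nthF 0) (zmulF ∘ fanoutFn (sndPow 1) (sndPow 1))

/-- `powBody ∈ FP`. [folklore] -/
theorem powBody_mem_FP : powBody ∈ FP :=
  comp_mem_FP zcapF_mem_FP (fanoutFn_mem_FP (nthF_mem_FP 0) (comp_mem_FP zmulF_mem_FP (fanoutFn_mem_FP (sndPow_mem_FP 1) (sndPow_mem_FP 1))))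

/-- Semantics of `powBody`. [folklore] -/
theorem powBody_apply (x cnt : List Bool) (a : ℤ) :
    powBody (boolPair x (boolPair cnt (dpEnc a))) = dpEnc (capZ x.length (a * a)) := by
  simp only [powBody, Function.comp_apply, fanoutFn_apply, nthF_zero_boolPair, sndPow_succ_boolPair, sndPow_zero,
    sndF_boolPair, zmulF_boolPair, ival_dpEnc]
  rw [zcapF_dpEnc_capZ]

/-- Growth of `powBody`: `≤ |state| + (2|x| + 2)`. [folklore] -/
theorem length_powBody_le (z : List Bool) :
    (powBody z).length ≤ (sndPow 1 z).length + (2 * X + 2 : Polynomial ℕ).eval (fstF z).length := by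
  have := length_zcapF_le (boolPair (nthF 0 z) ((zmulF ∘ fanoutFn (sndPow 1) (sndPow 1)) z))
  simp only [powBody, Function.comp_apply, fanoutFn_apply, fstF_boolPair, nthF_zero, eval_add, eval_mul, eval_ofNat,
    eval_X] at this ⊢
  omega

/-- **The power loop** `loopX powBody`: on `⟨x, ⟨bin k, dpEnc a⟩⟩` with `k ≤ |x|`, `k` rounds of `a ↦ capZ (a²)`.
[folklore] -/
def powLoopF : List Bool → List Bool := loopX powBody

/-- `powLoopF ∈ FP`. [cite: AroraBarak2009, §1.3 (bounded loops)] -/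
theorem powLoopF_mem_FP : powLoopF ∈ FP := loopX_mem_FP powBody_mem_FP length_powBody_le

/-- The capped squaring of an integer. [folklore] -/
def sqZ (W : ℕ) (a : ℤ) : ℤ := capZ W (a * a)

/-- The loop model of the power body iterates `sqZ`. [folklore] -/
theorem loopModel_powBody (x : List Bool) : ∀ (k : ℕ) (a : ℤ),
    loopModel powBody x k (dpEnc a) = dpEnc ((sqZ x.length)^[k] a)
  | 0, a => by simp [loopModel]
  | k + 1, a => by
    rw [loopModel, powBody_apply, loopModel_powBody x k, Function.iterate_succ_apply]
    rfl

/-- **Semantics of `powLoopF`** (`k ≤ |x|`). [folklore] -/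
theorem powLoopF_apply (x : List Bool) {k : ℕ} (hk : k ≤ x.length) (a : ℤ) :
    powLoopF (boolPair x (boolPair (encodeNat k) (dpEnc a))) = boolPair x (boolPair [] (dpEnc ((sqZ x.length)^[k] a))) := by
  rw [powLoopF, loopX_apply _ _ _ hk, loopModel_powBody]

/-- **The unsaturated power loop**: if `|a|^(2^k) < 2^W` then `(sqZ W)^[k] a = a^(2^k)`. [folklore] -/
theorem iterate_sqZ_eq_pow {W : ℕ} (a : ℤ) : ∀ k : ℕ, a.natAbs ^ 2 ^ k < 2 ^ W → (sqZ W)^[k] a = a ^ 2 ^ k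
  | 0, _ => by simp
  | k + 1, h => by
    have hle : a.natAbs ^ 2 ^ k ≤ a.natAbs ^ 2 ^ (k + 1) := by
      rcases Nat.eq_zero_or_pos a.natAbs with h0 | hpos
      · rw [h0, zero_pow (pow_ne_zero _ two_ne_zero), zero_pow (pow_ne_zero _ two_ne_zero)]
      · exact Nat.pow_le_pow_right hpos (Nat.pow_le_pow_right two_pos (Nat.le_succ k))
    have ih := iterate_sqZ_eq_pow a k (lt_of_le_of_lt hle h)
    rw [Function.iterate_succ_apply', ih, sqZ, ← pow_two, ← pow_mul, ← pow_succ]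
    refine capZ_of_lt ?_
    rwa [Int.natAbs_pow]

end ARMachine

end Literature.Algebra.EuclideanLattices

end
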